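import Summits.BirchSwinnertonDyer.Rank1Residual.GaloisImage.OrdinaryLineInertiaCyclotomic
import Literature.NumberTheory.EllipticCurves.ShaIsogenyProofs
import Literature.NumberTheory.EllipticCurves.HasseWeilAbelianNodalConductorProofs
import Literature.NumberTheory.EllipticCurves.LambdaInvariantCongruenceTransportAtTwo
import Literature.NumberTheory.EllipticCurves.NeronOggShafarevichLocal
import Summits.BirchSwinnertonDyer.BirchSwinnertonDyer.Theorems.ByReductionTypeAtTwoOrdIsogenyRescale
import Summits.BirchSwinnertonDyer.BirchSwinnertonDyer.Theorems.EisensteinDepletionAtTwoStarOptBNSFOddTransportArch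
import HarnessLib

/-!
# Line `nsf` v3 on crux `StarOptBNSF` (item stmt-BirchSwinnertonDyer-27047), stub `stub_oddIsoTwoAdic`:
# the four by-name helpers H1c / H1d / H2 / H3 of planner p2 GEN 32's skeleton
# (HOME/p2/g32/nsf/oddIsoTwoAdic_skel.lean, STUB-PLAN-stub_oddIsoTwoAdic.md)

Lead bsd-rank2-star-p1 GEN 7.  `stub_oddIsoTwoAdic`: an odd-degree isogeny between globally minimal
curves, `W` good ordinary at `2`, preserves the 2-ADIC type bit «ramified at 2» (`v₂(x) < 0`, the point
lies in the kernel of reduction) of the unique rational 2-torsion point.  The planner's skeleton proves it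
(kernel-checked composition `oddIsoTwoAdic_of_helpers`, and the inertia core H1) from four helpers, landed
here verbatim:

* `helper_ker_twoTorsion_singleton` (H1c) — at the place `v ∣ 2` of a globally minimal `W` good ordinary at
  `2`, `ker red_v ∩ E[2]` has exactly one non-zero element (generation clause of the tree's
  `exists_generator_and_inertia_smul_eq_of_not_dvd` with `k = 1`: every such `Q` is `j • g₁`, `2 g₁ = 0`);
* `helper_localPointsMap_twoTorsion_injective` (H1d) — an odd-degree isogeny kills no non-zero 2-torsion
  local point (`localPointsMap = φ.baseChange`, tree `Isogeny.ker_baseChange_eq_map`: the kernel of the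
  base change is `ι_*(ker φ)`, of odd order `deg φ`);
* `helper_localRed_ratPoint_eq_zero_iff` (H2, the DICTIONARY) — for a rational affine point `(x, y)` pushed
  to `E(K̄_v)`, `red_v = 0 ↔ v₂(x) < 0` (tree `localRed_eq_zero_iff_mem_kernel`, `some_mem_kernel_iff`,
  spectral valuation of a rational = `|·|₂` via Mathlib's `valuation_equiv_padicValuation`);
* `helper_isogeny_twoTorsion_coords` (H3) — the odd-degree isogeny maps the geometric point over the unique
  rational 2-torsion abscissa `x` of `W` to the one over `x′` of `W′` (`…OddTransportArch`:
  `exists_hasUniqueRationalTwoTorsionX_of_isogeny_of_odd`).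

HONEST FRAMING: helpers of a registered stub of an OPEN crux; `StarOptBNSF` / `E1M_NSF` / BSD are NOT proved
by them; nothing here reads an analytic rank.

References: R. Greenberg, LNM 1716 (1999), §2 p. 70, §5 p. 168 [GreenbergLNM1716]; R. Greenberg,
V. Vatsal, Invent. Math. 142 (2000), §2 p. 26 [GreenbergVatsal2000]; J. H. Silverman, *AEC*, GTM 106
(2009), III.4.9, VII.2.1–2.2 [SilvermanAEC2009].
-/

set_option linter.dupNamespace false
set_option autoImplicit false

noncomputable section

open scoped Classical NNReal
open NumberField IsDedekindDomain Field IsDedekindDomain.HeightOneSpectrum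
open Literature.NumberTheory.EllipticCurves Literature.NumberTheory.EllipticCurves.Greenberg1999
  Literature.NumberTheory.GaloisRepresentations Literature.NumberTheory.EllipticCurves.FormalGroupChart
open WeierstrassCurve (minimalDiscriminantInt)
open Summit.BirchSwinnertonDyer.Rank1Residual.X2.GreenbergVatsalReductionDatum (localRed specVal specVal_spec)
open Summit.BirchSwinnertonDyer.BirchSwinnertonDyer.Theorems.DepletionAtTwo.ArchTransport

namespace Summit.BirchSwinnertonDyer.BirchSwinnertonDyer.Theorems.DepletionAtTwo.OddIsoTwoAdic

universe u

/-! ### H1c — `ker red_v ∩ E[2]` is a singleton away from `0` -/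

/-- **H1c.** At the place `v ∋ 2` of a globally minimal `W/ℚ` with `2 ∤ Δ_W`, `2 ∤ a₂`: two non-zero
2-torsion points of `E(K̄_v)` in the kernel of reduction coincide — both are odd multiples of the level-1
generator `g₁` of the ordinary line (`exists_generator_and_inertia_smul_eq_of_not_dvd`, `k = 1`).
[cite: GreenbergLNM1716, §2 p. 70 (ℱ[p^∞] ≅ ℚ_p/ℤ_p)] [cite: GreenbergVatsal2000, §2 p. 26] -/
theorem helper_ker_twoTorsion_singleton (W : WeierstrassCurve ℚ) [W.IsElliptic] [W.IsGloballyMinimal]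
    {v : HeightOneSpectrum (𝓞 ℚ)} (hpv : ((2 : ℕ) : 𝓞 ℚ) ∈ v.asIdeal)
    (hΔ : ¬ (2 : ℤ) ∣ minimalDiscriminantInt W) (hord : ¬ (2 : ℤ) ∣ W.frobeniusTrace 2)
    (Q Q' : localPoints W (v.adicCompletion ℚ))
    (hQ2 : Q + Q = 0) (hQ0 : Q ≠ 0) (hQ : localRed W 2 hpv hΔ Q = 0)
    (hQ'2 : Q' + Q' = 0) (hQ'0 : Q' ≠ 0) (hQ' : localRed W 2 hpv hΔ Q' = 0) : Q = Q' := by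
  obtain ⟨g, -, hgord, hgen, -, -⟩ :=
    Summit.BirchSwinnertonDyer.Rank1Residual.GaloisImage.OrdinaryLineInertiaCyclotomic.exists_generator_and_inertia_smul_eq_of_not_dvd
      W 2 hpv hΔ hord 1 (u := 1) (by decide)
  rw [pow_one] at hgord
  have hg2 : g + g = 0 := by
    have h := addOrderOf_nsmul_eq_zero g
    rwa [hgord, two_nsmul] at h
  have htwo : ∀ R : localPoints W (v.adicCompletion ℚ), R + R = 0 → ((2 ^ 1 : ℕ) : ℤ) • R = 0 := by
    intro R hR
    rw [pow_one, natCast_zsmul, two_nsmul, hR]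
  have key : ∀ R : localPoints W (v.adicCompletion ℚ), R ≠ 0 → ∀ j : ℕ, R = j • g → R = g := by
    intro R hR0 j hj
    rcases Nat.even_or_odd j with ⟨k, rfl⟩ | ⟨k, rfl⟩
    · exfalso; apply hR0
      rw [hj, add_nsmul, ← nsmul_add, hg2, nsmul_zero]
    · rw [hj, add_nsmul, one_nsmul, mul_nsmul, two_nsmul, hg2, nsmul_zero, zero_add]
  obtain ⟨j, hj⟩ := hgen Q hQ (htwo Q hQ2)
  obtain ⟨j', hj'⟩ := hgen Q' hQ' (htwo Q' hQ'2)
  exact (key Q hQ0 j hj).trans (key Q' hQ'0 j' hj').symm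

/-! ### H1d — an odd-degree isogeny kills no non-zero 2-torsion local point -/

/-- **H1d.** For an isogeny `φ` of odd degree and a local point `P ∈ E(K̄_v)` with `2P = 0`:
`φ_v P = 0 ⇒ P = 0` (the kernel of `φ_v = φ.baseChange` is `ι_*(ker φ)`, tree `Isogeny.ker_baseChange_eq_map`,
of odd order `deg φ = #ker φ`; an element of order dividing `2` in it is `0`). [cite: SilvermanAEC2009, III.4.9] -/
theorem helper_localPointsMap_twoTorsion_injective (W W' : WeierstrassCurve ℚ) [W.IsElliptic] [W'.IsElliptic]
    (φ : WeierstrassCurve.Isogeny W W') (hodd : Odd φ.degree) {v : HeightOneSpectrum (𝓞 ℚ)}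
    (P : localPoints W (v.adicCompletion ℚ)) (h2 : P + P = 0)
    (hP : φ.localPointsMap (v.adicCompletion ℚ) P = 0) : P = 0 := by
  -- a 2-torsion local point is algebraic: `P = ι_* P₀` with `2 P₀ = 0`
  obtain ⟨P₀, h2₀, rfl⟩ := exists_pointsMapOfEmb_eq_of_nsmul_eq_zero W
    (closureEmb (K := ℚ) (v.adicCompletion ℚ)) (m := 2) two_ne_zero
    (Q := P) (by rw [two_nsmul]; exact h2)
  -- `φ P₀ = 0`
  have hφP₀ : φ P₀ = 0 := by
    apply pointsMapOfEmb_injective W' (closureEmb (K := ℚ) (v.adicCompletion ℚ))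
    rw [map_zero]
    have e := φ.localPointsMap_pointsMap (v.adicCompletion ℚ) P₀
    exact e.symm.trans hP
  -- its order divides `2` and the odd `deg φ = #ker φ`
  have hdvd2 : addOrderOf P₀ ∣ 2 := addOrderOf_dvd_of_nsmul_eq_zero h2₀
  have hdvdN : addOrderOf P₀ ∣ φ.degree := by
    have h := addOrderOf_dvd_natCard (⟨P₀, hφP₀⟩ : φ.toAddMonoidHom.ker)
    have e := addOrderOf_injective φ.toAddMonoidHom.ker.subtype Subtype.coe_injective ⟨P₀, hφP₀⟩
    rw [← e] at h
    exact h
  have h1 : addOrderOf P₀ = 1 := by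
    rcases (Nat.dvd_prime Nat.prime_two).mp hdvd2 with h | h
    · exact h
    · exfalso
      rw [h] at hdvdN
      exact (Nat.not_even_iff_odd.mpr hodd) (even_iff_two_dvd.mpr hdvdN)
  rw [AddMonoid.addOrderOf_eq_one_iff] at h1
  rw [h1, map_zero]

/-! ### H2 — the dictionary `red_v = 0 ↔ v₂(x) < 0` for rational points -/

/-- At the place `v ∋ 2`, the `v`-adic valuation of a rational is `> 1` iff its 2-adic order is negative
(Mathlib's `valuation_equiv_padicValuation`, `primesEquiv v = 2`). [folklore] -/
theorem one_lt_valuation_iff_padicValRat_neg {v : HeightOneSpectrum (𝓞 ℚ)}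
    (hpv : ((2 : ℕ) : 𝓞 ℚ) ∈ v.asIdeal) (x : ℚ) :
    1 < v.valuation ℚ x ↔ padicValRat 2 x < 0 := by
  by_cases hx : x = 0
  · subst hx; simp
  have hp2 : ((Rat.HeightOneSpectrum.primesEquiv v : Nat.Primes) : ℕ) = 2 :=
    Rat.HeightOneSpectrum.primesEquiv_eq_of_natCast_mem v Nat.prime_two hpv
  have hequiv := Rat.HeightOneSpectrum.valuation_equiv_padicValuation v
  rw [hequiv.one_lt_iff_one_lt]
  change (1 : WithZero (Multiplicative ℤ)) <
      (if x = 0 then (0 : WithZero (Multiplicative ℤ))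
        else WithZero.exp (-padicValRat ((Rat.HeightOneSpectrum.primesEquiv v : Nat.Primes) : ℕ) x)) ↔ _
  rw [if_neg hx, hp2, ← WithZero.exp_zero, WithZero.exp_lt_exp, neg_pos]

/-- At the place `v ∋ 2`, a rational has spectral valuation `> 1` in `K̄_v` iff its 2-adic order is negative.
[folklore] -/
theorem one_lt_specVal_algebraMap_iff {v : HeightOneSpectrum (𝓞 ℚ)} (hpv : ((2 : ℕ) : 𝓞 ℚ) ∈ v.asIdeal)
    (x : ℚ) :
    1 < specVal v (algebraMap ℚ (AlgebraicClosure (v.adicCompletion ℚ)) x) ↔ padicValRat 2 x < 0 := by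
  have hw := specVal_spec v
  rw [IsScalarTower.algebraMap_apply ℚ (v.adicCompletion ℚ) (AlgebraicClosure (v.adicCompletion ℚ)),
    ← NNReal.coe_lt_coe, coe_spectralValuation_algebraMap hw, NNReal.coe_one,
    Valued.toNormedField.one_lt_norm_iff]
  have hv : Valued.v (algebraMap ℚ (v.adicCompletion ℚ) x) = v.valuation ℚ x :=
    valuedAdicCompletion_eq_valuation' v x
  rw [hv]
  exact one_lt_valuation_iff_padicValRat_neg hpv x

/-- **H2 (the dictionary).**  For a point with RATIONAL coordinates `(x, y)` of the globally minimal `W`,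
pushed to `E(K̄_v)` along the chosen embedding, `red_v = 0 ↔ v₂(x) < 0` — Greenberg's «`⟨P⟩` ramified at
`2` iff `P` lies in the kernel of reduction», on the minimal model `E₁ = {v(x) < 0}` (Silverman VII.2).
[cite: SilvermanAEC2009, VII.2 Props. 2.1–2.2] [cite: GreenbergLNM1716, §5 p. 168 and p. 176] -/
theorem helper_localRed_ratPoint_eq_zero_iff (W : WeierstrassCurve ℚ) [W.IsElliptic] [W.IsGloballyMinimal]
    {v : HeightOneSpectrum (𝓞 ℚ)} (hpv : ((2 : ℕ) : 𝓞 ℚ) ∈ v.asIdeal)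
    (hΔ : ¬ (2 : ℤ) ∣ minimalDiscriminantInt W) (x y : ℚ)
    (h : (W.baseChange (AlgebraicClosure ℚ)).toAffine.Nonsingular
      (algebraMap ℚ (AlgebraicClosure ℚ) x) (algebraMap ℚ (AlgebraicClosure ℚ) y)) :
    localRed W 2 hpv hΔ (pointsMap W (v.adicCompletion ℚ) (WeierstrassCurve.Affine.Point.some _ _ h)) = 0 ↔
      TwoTorsionRamifiedAtTwo x := by
  have hw := specVal_spec v
  have hΔu : IsUnit ((WeierstrassCurve.integralModelInt W).map
      (algebraMap ℤ ↥(specVal v).valuationSubring)).Δ :=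
    W.isUnit_Δ_localIntModel hpv hw hΔ
  haveI hV : (W.baseChange (AlgebraicClosure (v.adicCompletion ℚ))).IsIntegral (specVal v).integer :=
    ⟨⟨(WeierstrassCurve.integralModelInt W).map (algebraMap ℤ ↥(specVal v).integer),
      W.baseChange_eq_localIntModel_integer_baseChange⟩⟩
  obtain ⟨hC, hP⟩ : ∃ hC, pointsMap W (v.adicCompletion ℚ) (WeierstrassCurve.Affine.Point.some _ _ h) =
      WeierstrassCurve.Affine.Point.some
        (closureEmb (K := ℚ) (v.adicCompletion ℚ) (algebraMap ℚ (AlgebraicClosure ℚ) x))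
        (closureEmb (K := ℚ) (v.adicCompletion ℚ) (algebraMap ℚ (AlgebraicClosure ℚ) y)) hC :=
    ⟨_, rfl⟩
  rw [hP, W.localRed_eq_zero_iff_mem_kernel hΔu (localRed W 2 hpv hΔ)
    (Summit.BirchSwinnertonDyer.Rank1Residual.X2.GreenbergVatsalReductionDatum.localRed_apply W 2 hpv hΔ)]
  change (WeierstrassCurve.Affine.Point.some _ _ hC :
      (W.baseChange (AlgebraicClosure (v.adicCompletion ℚ))).toAffine.Point) ∈
    kernel (specVal v) (W.baseChange (AlgebraicClosure (v.adicCompletion ℚ))) ↔ _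
  have hcomm : closureEmb (K := ℚ) (v.adicCompletion ℚ) (algebraMap ℚ (AlgebraicClosure ℚ) x) =
      algebraMap ℚ (AlgebraicClosure (v.adicCompletion ℚ)) x :=
    (closureEmb (K := ℚ) (v.adicCompletion ℚ)).commutes x
  rw [some_mem_kernel_iff (w := specVal v) hC, hcomm, twoTorsionRamifiedAtTwo_iff]
  exact one_lt_specVal_algebraMap_iff hpv x

/-! ### H3 — coordinate transport of the unique rational 2-torsion point -/

/-- **H3.**  An odd-degree isogeny carries the geometric point over the unique rational 2-torsion abscissa
`x` of `W` to the geometric point over the unique rational 2-torsion abscissa `x′` of `W′`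
(`exists_hasUniqueRationalTwoTorsionX_of_isogeny_of_odd` + uniqueness on `W′`).
[cite: SilvermanAEC2009, III.4.11, VIII.§1] -/
theorem helper_isogeny_twoTorsion_coords (W W' : WeierstrassCurve ℚ) [W.IsElliptic] [W'.IsElliptic]
    (φ : WeierstrassCurve.Isogeny W W') (hodd : Odd φ.degree) (x x' : ℚ)
    (hux : HasUniqueRationalTwoTorsionX W x) (hux' : HasUniqueRationalTwoTorsionX W' x') :
    ∃ (T : W.geomPoints) (T' : W'.geomPoints) (y y' : ℚ)
      (h : (W.baseChange (AlgebraicClosure ℚ)).toAffine.Nonsingular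
        (algebraMap ℚ (AlgebraicClosure ℚ) x) (algebraMap ℚ (AlgebraicClosure ℚ) y))
      (h' : (W'.baseChange (AlgebraicClosure ℚ)).toAffine.Nonsingular
        (algebraMap ℚ (AlgebraicClosure ℚ) x') (algebraMap ℚ (AlgebraicClosure ℚ) y')),
      T = WeierstrassCurve.Affine.Point.some _ _ h ∧ T' = WeierstrassCurve.Affine.Point.some _ _ h' ∧
      φ T = T' ∧ T + T = 0 ∧ T ≠ 0 := by
  obtain ⟨⟨y, hxy, h2⟩, huniq⟩ := hux
  have hT : W.toAffine.Nonsingular x y := (WeierstrassCurve.Affine.equation_iff_nonsingular).mp hxy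
  obtain ⟨x₁, y₁, hT₁, hφ, hx₁⟩ := exists_hasUniqueRationalTwoTorsionX_of_isogeny_of_odd φ hodd hT h2 huniq
  have hx₁x' : x₁ = x' := hux'.2 x₁ hx₁.1
  subst hx₁x'
  obtain ⟨hC, hG⟩ := toGeomPoints_some W hT
  obtain ⟨hC', hG'⟩ := toGeomPoints_some W' hT₁
  exact ⟨_, _, y, y₁, hC, hC', hG, hG', hφ, toGeomPoints_add_self_eq_zero W hT h2,
    toGeomPoints_some_ne_zero' W hT⟩

end Summit.BirchSwinnertonDyer.BirchSwinnertonDyer.Theorems.DepletionAtTwo.OddIsoTwoAdic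

end
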